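import Literature.NumberTheory.Automorphic.GL2WeightVectors
import Literature.NumberTheory.Automorphic.NewformAdelisationArchTransport
import Literature.NumberTheory.Automorphic.GL2CasimirScalar
import Literature.NumberTheory.Automorphic.StrongArtinGL2WeightOneDictionary
import Literature.NumberTheory.Automorphic.AutomorphicRepLieActionGL
import Literature.NumberTheory.Automorphic.AutomorphicFormsSpan
import HarnessLib

/-!
# Weight vectors on `GL₂(𝔸_ℚ)`: the archimedean calculus of the `GL₂/ℚ` automorphy datum read along
`GL₂(ℝ) → GL₂(𝔸_ℚ)`, `g ↦ (g, 1)`, and the extraction of a weight-one vector killed by `X`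

Topic `NumberTheory/Automorphic`; a brick of the dictionary in the direction `π ↦ f_π`
(Gelbart 1997, Prop. 2.5, converse; hypothesis `hdesc` of `StrongArtinGL2WeightOneDictionary`).
The archimedean structure of the Borel–Jacquet datum `AutomorphyDatum.gl 2 ℚ` lives on
`GL₂(mixedSpace ℚ)` and its Lie subalgebra `⊤`; the `SO(2)`-weight calculus of `GL2WeightVectors`
lives on functions read along a homomorphism out of the linear real group `GL₂(ℝ)`. This file
identifies the two along `ι_𝔸 : GL₂(ℝ) → GL₂(𝔸_ℚ)`, `g ↦ (g, 1)` (`Rat.iotaA`) at *every* point of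
`GL₂(𝔸_ℚ)`, moves the archimedean parameter `{0, 0}` of a weight-one `π` (through the Casimir
computation of `GL2CasimirScalar`) onto the functions of `π.W`, and extracts the weight-one vector:

* `Rat.iotaA`, `Rat.mul_ofArch_expMem_lieOfReal`, `Rat.lieDeriv_ofArch_lieOfReal_eq`
  (**`(X ⊗ 1) φ = X φ`** on all of `GL₂(𝔸_ℚ)`), `IsArchSmooth.iotaA`,
  `Rat.realToMixedGL_mem_maximalCompact` (orthogonal matrices land in `K_∞`),
  `Rat.archTranslate_iotaA_eq_rightTranslation_ofK`, `Rat.realPlaceLie_eq_map`,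
  `Rat.topEquiv_symm_realPlaceLie`, `Rat.iotaA_rotK_pi` (`ι_𝔸(k_π) = (-1)_∞`);
* `AutomorphicRepData.lieDeriv_one_sub_smul_mem` — **`Z φ - (s₁ + s₂) φ ∈ W'`** — and
  `AutomorphicRepData.sum_lieDeriv_single_sub_smul_mem` —
  **`∑_{a,b} E_{ab} E_{ba} φ - (s₁² + s₂² - ½) φ ∈ W'`** — for `π` of archimedean parameter `{s₁, s₂}`
  and `φ ∈ W` (`GL2Casimir.rho_one_apply_of_hasHCParameter`,
  `GL2Casimir.sum_rho_single_apply_of_hasHCParameter` through `HasLieAction`);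
* `GL2Real.casimirFun_add_half_zz` — **`Ω φ + ½ Z(Zφ) = ∑_{a,b} E_{ab} E_{ba} φ`** for arch-smooth `φ`
  (`Ω = ½h² + ef + fe`, `C = Ω + ½Z²`; Bump 1997, §2.2);
* `AutomorphicRepData.exists_finiteDimensional_rotation_span` (`K_∞`-finiteness along `ι_𝔸`);
* `AutomorphicRepData.exists_isWeightVec_one_of_isOfWeightOne` — **for `π` of weight one with
  `W' = ⊥` and any subspace `W₁ ≤ W` stable under `ε`, the rotations and `𝔤𝔩₂(ℝ)`, every non-zero
  `φ ∈ W₁` yields a non-zero `ψ ∈ W₁` of weight one with `X ψ = 0` and `Z ψ = 0`**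
  (`Z = 0` and `Ω = -½` exactly on `W`, the sign `k_π ↦ -1`, and
  `GL2Real.exists_isWeightVec_one_lowerFun_eq_zero_of_finite`); primed version for `W₁ = W`.
  This is Gelbart 1997, Remark 2.5.2 / 2.5.5 (`π_∞ = π(1, sgn)` has a lowest weight vector of
  weight one) for the datum.

Everything is proved; the definitions are `Rat.ofRealGLA` (`= Rat.ofRealGL 2` with values in the
datum's function type) and the abbreviation `Rat.iotaA`.

## References

* S. Gelbart, *Three lectures on the modularity of `ρ̄_{E,3}` and the Langlands reciprocity
  conjecture*, in *Modular forms and Fermat's last theorem* (1997), Remarks 2.5.2, 2.5.5 [Gelbart1997].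
* D. Bump, *Automorphic forms and representations* (1997), §2.2, Prop. 2.2.5, Exercise 2.1.7,
  §2.5 [Bump1997].
* A. Borel, H. Jacquet, *Automorphic forms and automorphic representations*, Corvallis (1979),
  §1.5, 4.6 [BorelJacquetCorvallis1979].
-/

noncomputable section

open scoped MatrixGroups Matrix ContDiff Topology Classical
open NumberField NumberField.mixedEmbedding IsDedekindDomain

namespace Literature.NumberTheory.Automorphic

-- Mathlib idiom (Mathlib/Algebra/Lie/OfAssociative.lean); needed to mention Lie subalgebras of matrix algebras
attribute [local instance 100] LieRing.ofAssociativeRing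

open GL2Real

section IotaA

/-- The embedding `GL₂(ℝ) → GL₂(𝔸_ℚ)`, `g ↦ (g, 1)` (`Rat.ofRealGL 2`), with values in the syntactic
type `(AdelicGroupData.gl 2 ℚ).Adelic` of the trunk (definitionally `GL (Fin 2) (AdeleRing (𝓞 ℚ) ℚ)`),
so that `archTranslate`/`lieDeriv` along it act on the same function type as the automorphy datum.
[folklore] -/
def Rat.ofRealGLA : GL (Fin 2) ℝ →* (AdelicGroupData.gl 2 ℚ).Adelic := Rat.ofRealGL 2

/-- `Rat.ofRealGLA g = Rat.ofRealGL 2 g` (definitional). [folklore] -/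
theorem Rat.ofRealGLA_apply (g : GL (Fin 2) ℝ) :
    Rat.ofRealGLA g = (show (AdelicGroupData.gl 2 ℚ).Adelic from Rat.ofRealGL 2 g) := rfl

/-- The archimedean homomorphism `ι_𝔸 : GL₂(ℝ) → GL₂(𝔸_ℚ)` on (the carrier `⊤` of) the linear real
group `GL₂(ℝ)` (`GL2Real.inclOf Rat.ofRealGLA`). [folklore] -/
abbrev Rat.iotaA : (RealMatrixGroup.gl ℝ (Fin 2)).carrier →* (AdelicGroupData.gl 2 ℚ).Adelic :=
  inclOf Rat.ofRealGLA

variable {hcpt : isCompact_glFiniteIntegralLevel 2 ℚ}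

/-- **The one-parameter subgroups agree at every base point**:
`g · ofArch(exp(t (X ⊗ 1))) = g · ι_𝔸(exp(tX))` in `GL₂(𝔸_ℚ)`. [folklore] -/
theorem Rat.mul_ofArch_expMem_lieOfReal (g : (AdelicGroupData.gl 2 ℚ).Adelic) (X : Matrix (Fin 2) (Fin 2) ℝ) (t : ℝ) :
    g * (AutomorphyDatum.gl 2 ℚ hcpt).ofArch ((AutomorphyDatum.gl 2 ℚ hcpt).arch.expMem (t • Rat.lieOfReal hcpt X)) =
      g * Rat.iotaA ((RealMatrixGroup.gl ℝ (Fin 2)).expMem (t • toLie X)) := by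
  congr 1
  rw [Rat.ofArch_expMem_smul_lieOfReal]
  change GLn.ofInfinite 2 ℚ (expGL (t • X.map (algebraMap ℝ (mixedSpace ℚ)))) = Rat.ofRealGL 2 (expGL (t • X))
  rw [Rat.ofRealGL_expGL, Rat.map_algebraMap_mixedSpace_smul]

/-- **Lie derivatives along the datum are Lie derivatives along `ι_𝔸`, at every point**:
`(X ⊗ 1) φ = X φ` as functions on `GL₂(𝔸_ℚ)` (`X ∈ 𝔤𝔩₂(ℝ)`), extending
`lieDeriv_ofArch_ofRealGL` of `NewformAdelisationArchTransport` off `GL₂(ℝ) × {1}`.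
[cite: BorelJacquetCorvallis1979, §1.5] -/
theorem Rat.lieDeriv_ofArch_lieOfReal_eq (φ : (AdelicGroupData.gl 2 ℚ).Adelic → ℂ) (X : Matrix (Fin 2) (Fin 2) ℝ) :
    lieDeriv (AutomorphyDatum.gl 2 ℚ hcpt).ofArch (Rat.lieOfReal hcpt X) φ = lieDeriv Rat.iotaA (toLie X) φ := by
  funext g
  unfold lieDeriv
  congr 1
  funext t
  rw [Rat.mul_ofArch_expMem_lieOfReal]

set_option backward.isDefEq.respectTransparency false in
open scoped Matrix.Norms.Operator in
/-- **Archimedean smoothness along the datum gives archimedean smoothness along `ι_𝔸`** (at every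
base point of `GL₂(𝔸_ℚ)`; the slice along `ι_𝔸` is the slice along the datum composed with
`X ↦ X ⊗ 1`). [cite: BorelJacquetCorvallis1979, §4.1] -/
theorem IsArchSmooth.iotaA {φ : (AdelicGroupData.gl 2 ℚ).Adelic → ℂ}
    (hφ : IsArchSmooth (AutomorphyDatum.gl 2 ℚ hcpt).ofArch φ) : IsArchSmooth Rat.iotaA φ := by
  intro g
  let L : (RealMatrixGroup.gl ℝ (Fin 2)).lie.toSubmodule →ₗ[ℝ]
      (AutomorphyDatum.gl 2 ℚ hcpt).arch.lie.toSubmodule :=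
    LinearMap.codRestrict _
      (((Algebra.linearMap ℝ (mixedSpace ℚ)).mapMatrix : Matrix (Fin 2) (Fin 2) ℝ →ₗ[ℝ]
          Matrix (Fin 2) (Fin 2) (mixedSpace ℚ)) ∘ₗ (RealMatrixGroup.gl ℝ (Fin 2)).lie.toSubmodule.subtype)
      fun _ => LieSubalgebra.mem_top _
  have hL : ContDiff ℝ ∞ (L : (RealMatrixGroup.gl ℝ (Fin 2)).lie.toSubmodule →
      (AutomorphyDatum.gl 2 ℚ hcpt).arch.lie.toSubmodule) :=
    (⟨L, L.continuous_of_finiteDimensional⟩ :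
      (RealMatrixGroup.gl ℝ (Fin 2)).lie.toSubmodule →L[ℝ]
        (AutomorphyDatum.gl 2 ℚ hcpt).arch.lie.toSubmodule).contDiff
  have h := (hφ g).comp hL
  have e : (fun X : (RealMatrixGroup.gl ℝ (Fin 2)).lie.toSubmodule =>
      φ (g * Rat.iotaA ((RealMatrixGroup.gl ℝ (Fin 2)).expMem ⟨(X : Matrix (Fin 2) (Fin 2) ℝ), X.2⟩))) =
      (fun Y : (AutomorphyDatum.gl 2 ℚ hcpt).arch.lie.toSubmodule =>
        φ (g * (AutomorphyDatum.gl 2 ℚ hcpt).ofArch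
          ((AutomorphyDatum.gl 2 ℚ hcpt).arch.expMem ⟨(Y : Matrix (Fin 2) (Fin 2) (mixedSpace ℚ)), Y.2⟩))) ∘ L := by
    funext X
    have h1 := Rat.mul_ofArch_expMem_lieOfReal (hcpt := hcpt) g (X : Matrix (Fin 2) (Fin 2) ℝ) 1
    rw [one_smul, one_smul] at h1
    exact congrArg φ h1.symm
  rw [e]
  exact h

/-- **Rotations and the reflection land in `K_∞`**: a real matrix `M` with `Mᵀ M = 1` maps to the
maximal compact subgroup (the unitary group) of the archimedean group `GL₂(mixedSpace ℚ)` of the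
datum. [folklore] -/
theorem Rat.realToMixedGL_mem_maximalCompact {g : GL (Fin 2) ℝ}
    (h : (g : Matrix (Fin 2) (Fin 2) ℝ)ᵀ * (g : Matrix (Fin 2) (Fin 2) ℝ) = 1) :
    Rat.realToMixedGL 2 g ∈ (AutomorphyDatum.gl 2 ℚ hcpt).arch.maximalCompact := by
  refine ⟨Subgroup.mem_top _, ?_⟩
  change Rat.realToMixedGL 2 g ∈ unitarySubgroupGL (mixedSpace ℚ) (Fin 2)
  rw [mem_unitarySubgroupGL_iff]
  have hstar : star ((Rat.realToMixedGL 2 g : GL (Fin 2) (mixedSpace ℚ)) : Matrix (Fin 2) (Fin 2) (mixedSpace ℚ)) =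
      ((g : Matrix (Fin 2) (Fin 2) ℝ)ᵀ).map (algebraMap ℝ (mixedSpace ℚ)) := by
    ext i j
    · simp [Matrix.star_apply, Matrix.map_apply, Matrix.transpose_apply, Rat.realToMixedGL, Prod.algebraMap_apply,
        Pi.algebraMap_apply]
    · rename_i x
      exact absurd x.2 (NumberField.InfinitePlace.not_isComplex_iff_isReal.2
        (by rw [Subsingleton.elim x.1 Rat.infinitePlace]; exact Rat.isReal_infinitePlace))
  rw [hstar]
  change ((g : Matrix (Fin 2) (Fin 2) ℝ)ᵀ).map (algebraMap ℝ (mixedSpace ℚ)) *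
      (g : Matrix (Fin 2) (Fin 2) ℝ).map (algebraMap ℝ (mixedSpace ℚ)) = 1
  rw [← Matrix.map_mul, h, Matrix.map_one _ (map_zero _) (map_one _)]

/-- `k_θᵀ k_θ = 1`. [folklore] -/
theorem transpose_rotK_mul (θ : ℝ) :
    ((((rotK θ : (RealMatrixGroup.gl ℝ (Fin 2)).carrier) : GL (Fin 2) ℝ) : Matrix (Fin 2) (Fin 2) ℝ))ᵀ *
      (((rotK θ : (RealMatrixGroup.gl ℝ (Fin 2)).carrier) : GL (Fin 2) ℝ) : Matrix (Fin 2) (Fin 2) ℝ) = 1 := by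
  rw [coe_rotK, coe_rotGL]
  ext i j
  fin_cases i <;> fin_cases j <;> simp [Matrix.mul_apply, Fin.sum_univ_two, Real.cos_neg, Real.sin_neg] <;>
    nlinarith [Real.cos_sq_add_sin_sq θ]

/-- `εᵀ ε = 1`. [folklore] -/
theorem transpose_epsK_mul :
    ((((epsK : (RealMatrixGroup.gl ℝ (Fin 2)).carrier) : GL (Fin 2) ℝ) : Matrix (Fin 2) (Fin 2) ℝ))ᵀ *
      (((epsK : (RealMatrixGroup.gl ℝ (Fin 2)).carrier) : GL (Fin 2) ℝ) : Matrix (Fin 2) (Fin 2) ℝ) = 1 := by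
  rw [coe_epsK, coe_epsGL]
  ext i j
  fin_cases i <;> fin_cases j <;> simp [Matrix.mul_apply, Fin.sum_univ_two]

/-- **Right translation by `ι_𝔸(k)` is right translation by an element of `K_∞`** for `kᵀ k = 1`:
`archTranslate ι_𝔸 k = rightTranslation (ofK ⟨k ⊗ 1, _⟩)`. [folklore] -/
theorem Rat.archTranslate_iotaA_eq_rightTranslation_ofK (k : (RealMatrixGroup.gl ℝ (Fin 2)).carrier)
    (h : ((k : GL (Fin 2) ℝ) : Matrix (Fin 2) (Fin 2) ℝ)ᵀ * ((k : GL (Fin 2) ℝ) : Matrix (Fin 2) (Fin 2) ℝ) = 1)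
    (φ : (AdelicGroupData.gl 2 ℚ).Adelic → ℂ) :
    archTranslate Rat.iotaA k φ =
      rightTranslation (AdelicGroupData.gl 2 ℚ)
        ((AutomorphyDatum.gl 2 ℚ hcpt).ofK ⟨Rat.realToMixedGL 2 (k : GL (Fin 2) ℝ), Rat.realToMixedGL_mem_maximalCompact h⟩) φ := by
  funext g
  rw [archTranslate_apply, rightTranslation_apply]
  congr 1
  change g * (show (AdelicGroupData.gl 2 ℚ).Adelic from Rat.ofRealGL 2 (k : GL (Fin 2) ℝ)) = _
  rw [Rat.ofRealGL_eq_ofInfinite]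
  rfl

end IotaA

/-! ### The Casimir operator and `Z` on an automorphic representation of `GL₂(𝔸_ℚ)` with an
archimedean parameter -/

section CasimirBridge

variable {hcpt : isCompact_glFiniteIntegralLevel 2 ℚ}

/-- **For `K = ℚ` the factor inclusion at the real place is `X ↦ X ⊗ 1`**: `realPlaceLie 2 w X`
(the matrix over `mixedSpace ℚ = ℝ^{1} × ℂ^{0}` supported at `w`) is `X.map (algebraMap ℝ _)`.
[folklore] -/
theorem Rat.realPlaceLie_eq_map (w : {w : InfinitePlace ℚ // w.IsReal}) (X : Matrix (Fin 2) (Fin 2) ℝ) :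
    realPlaceLie 2 w X = X.map (algebraMap ℝ (mixedSpace ℚ)) := by
  ext i j
  · rw [realPlaceLie_apply, Matrix.map_apply]
    rename_i w'
    have hw : w' = w := Subsingleton.elim _ _
    subst hw
    simp
  · rename_i w'
    exact absurd w'.2 (NumberField.InfinitePlace.not_isComplex_iff_isReal.2
      (by rw [Subsingleton.elim w'.1 Rat.infinitePlace]; exact Rat.isReal_infinitePlace))

/-- The corresponding elements of the archimedean Lie algebra of the datum agree:
`topEquiv⁻¹ (realPlaceLie 2 w X) = Rat.lieOfReal hcpt X`. [folklore] -/
theorem Rat.topEquiv_symm_realPlaceLie (w : {w : InfinitePlace ℚ // w.IsReal}) (X : Matrix (Fin 2) (Fin 2) ℝ) :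
    (LieSubalgebra.topEquiv : (⊤ : LieSubalgebra ℝ (Matrix (Fin 2) (Fin 2) (mixedSpace ℚ))) ≃ₗ⁅ℝ⁆
        Matrix (Fin 2) (Fin 2) (mixedSpace ℚ)).symm (realPlaceLie 2 w X) = Rat.lieOfReal hcpt X := by
  refine Subtype.ext ?_
  change realPlaceLie 2 w X = X.map (algebraMap ℝ (mixedSpace ℚ))
  exact Rat.realPlaceLie_eq_map w X

namespace AutomorphicRepData

variable (π : AutomorphicRepData (AutomorphyDatum.gl 2 ℚ hcpt))

/-- The Lie derivative `E φ` along `ι_𝔸`, `E ∈ 𝔤𝔩₂(ℝ)`, of `φ ∈ W` lies in `W` (it is the Lie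
derivative along the datum of `E ⊗ 1`, `Rat.lieDeriv_ofArch_lieOfReal_eq`). [cite: BorelJacquetCorvallis1979, 4.6] -/
theorem lieDeriv_iotaA_mem {φ : (AdelicGroupData.gl 2 ℚ).Adelic → ℂ} (hφ : φ ∈ π.W) (X : Matrix (Fin 2) (Fin 2) ℝ) :
    lieDeriv Rat.iotaA (toLie X) φ ∈ π.W := by
  rw [← Rat.lieDeriv_ofArch_lieOfReal_eq (hcpt := hcpt)]
  exact π.stable.lie_stable _ φ hφ

/-- Same for `W'`. [cite: BorelJacquetCorvallis1979, 4.6] -/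
theorem lieDeriv_iotaA_mem' {φ : (AdelicGroupData.gl 2 ℚ).Adelic → ℂ} (hφ : φ ∈ π.W') (X : Matrix (Fin 2) (Fin 2) ℝ) :
    lieDeriv Rat.iotaA (toLie X) φ ∈ π.W' := by
  rw [← Rat.lieDeriv_ofArch_lieOfReal_eq (hcpt := hcpt)]
  exact π.stable'.lie_stable _ φ hφ

/-- **The infinitesimal character on vectors, I: `Z`.** If `π = W / W'` has archimedean parameter
`{s₁, s₂}`, then `Z φ - (s₁ + s₂) φ ∈ W'` for every `φ ∈ W`, `Z = 1 ∈ 𝔤𝔩₂(ℝ)` acting along `ι_𝔸`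
(`GL2Casimir.rho_one_apply_of_hasHCParameter` on `[φ] ∈ W / W'`, and `ρ𝔤 X [φ] = [Xφ]`).
[cite: Knapp2002, Thm. 5.44] [cite: Gelbart1997, Remark 2.5.5] -/
theorem lieDeriv_one_sub_smul_mem {s₁ s₂ : ℂ} (h : π.HasArchParameter fun _ => ({s₁, s₂} : Multiset ℂ))
    {φ : (AdelicGroupData.gl 2 ℚ).Adelic → ℂ} (hφ : φ ∈ π.W) :
    lieDeriv Rat.iotaA (toLie 1) φ - (s₁ + s₂) • φ ∈ π.W' := by
  obtain ⟨ρ𝔤, hLie, hpar⟩ := h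
  set w : {w : InfinitePlace ℚ // w.IsReal} := ⟨default, Rat.isReal_default_infinitePlace⟩
  have hHC := hpar.1 w
  set ρ' := (ρ𝔤.comp (LieSubalgebra.topEquiv :
      (⊤ : LieSubalgebra ℝ (Matrix (Fin 2) (Fin 2) (mixedSpace ℚ))) ≃ₗ⁅ℝ⁆
        Matrix (Fin 2) (Fin 2) (mixedSpace ℚ)).symm.toLieHom).comp (realPlaceLie 2 w) with hρ'
  have key := GL2Casimir.rho_one_apply_of_hasHCParameter (ρ := ρ') hHC (π.mkQ ⟨φ, hφ⟩)
  -- `ρ' 1 [φ] = [Z φ]`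
  have h1 : ρ' (1 : Matrix (Fin 2) (Fin 2) ℝ) (π.mkQ ⟨φ, hφ⟩) = π.mkQ (π.lieDerivW (Rat.lieOfReal hcpt 1) ⟨φ, hφ⟩) := by
    change ρ𝔤 ((LieSubalgebra.topEquiv : (⊤ : LieSubalgebra ℝ (Matrix (Fin 2) (Fin 2) (mixedSpace ℚ))) ≃ₗ⁅ℝ⁆
        Matrix (Fin 2) (Fin 2) (mixedSpace ℚ)).symm (realPlaceLie 2 w 1)) (π.mkQ ⟨φ, hφ⟩) = _
    rw [Rat.topEquiv_symm_realPlaceLie]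
    exact hLie _ _
  rw [h1, ← map_smul, ← sub_eq_zero, ← map_sub, Submodule.mkQ_apply, Submodule.Quotient.mk_eq_zero] at key
  have key' : ((π.lieDerivW (Rat.lieOfReal hcpt 1) ⟨φ, hφ⟩ - (s₁ + s₂) • (⟨φ, hφ⟩ : π.W) : π.W) :
      (AdelicGroupData.gl 2 ℚ).Adelic → ℂ) ∈ π.W' := key
  have e : ((π.lieDerivW (Rat.lieOfReal hcpt 1) ⟨φ, hφ⟩ - (s₁ + s₂) • (⟨φ, hφ⟩ : π.W) : π.W) :
      (AdelicGroupData.gl 2 ℚ).Adelic → ℂ) =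
      lieDeriv (AutomorphyDatum.gl 2 ℚ hcpt).ofArch (Rat.lieOfReal hcpt 1) φ - (s₁ + s₂) • φ := rfl
  rw [e, Rat.lieDeriv_ofArch_lieOfReal_eq] at key'
  exact key'

/-- **The infinitesimal character on vectors, II: the Casimir element.** If `π = W / W'` has
archimedean parameter `{s₁, s₂}`, then for every `φ ∈ W`,
`∑_{a,b} E_{ab}(E_{ba} φ) - (s₁² + s₂² - ½) φ ∈ W'`, the `E_{ab}` acting along `ι_𝔸`
(`GL2Casimir.sum_rho_single_apply_of_hasHCParameter` on `[φ]`). [cite: Knapp2002, Thm. 5.44]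
[cite: Gelbart1997, Remark 2.5.5] -/
theorem sum_lieDeriv_single_sub_smul_mem {s₁ s₂ : ℂ} (h : π.HasArchParameter fun _ => ({s₁, s₂} : Multiset ℂ))
    {φ : (AdelicGroupData.gl 2 ℚ).Adelic → ℂ} (hφ : φ ∈ π.W) :
    (∑ a : Fin 2, ∑ b : Fin 2, lieDeriv Rat.iotaA (toLie (Matrix.single a b (1 : ℝ)))
        (lieDeriv Rat.iotaA (toLie (Matrix.single b a (1 : ℝ))) φ)) - (s₁ ^ 2 + s₂ ^ 2 - 1 / 2) • φ ∈ π.W' := by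
  obtain ⟨ρ𝔤, hLie, hpar⟩ := h
  set w : {w : InfinitePlace ℚ // w.IsReal} := ⟨default, Rat.isReal_default_infinitePlace⟩
  have hHC := hpar.1 w
  set ρ' := (ρ𝔤.comp (LieSubalgebra.topEquiv :
      (⊤ : LieSubalgebra ℝ (Matrix (Fin 2) (Fin 2) (mixedSpace ℚ))) ≃ₗ⁅ℝ⁆
        Matrix (Fin 2) (Fin 2) (mixedSpace ℚ)).symm.toLieHom).comp (realPlaceLie 2 w) with hρ'
  have key := GL2Casimir.sum_rho_single_apply_of_hasHCParameter (ρ := ρ') hHC (π.mkQ ⟨φ, hφ⟩)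
  have hact : ∀ (X : Matrix (Fin 2) (Fin 2) ℝ) (ψ : π.W),
      ρ' X (π.mkQ ψ) = π.mkQ (π.lieDerivW (Rat.lieOfReal hcpt X) ψ) := by
    intro X ψ
    change ρ𝔤 ((LieSubalgebra.topEquiv : (⊤ : LieSubalgebra ℝ (Matrix (Fin 2) (Fin 2) (mixedSpace ℚ))) ≃ₗ⁅ℝ⁆
        Matrix (Fin 2) (Fin 2) (mixedSpace ℚ)).symm (realPlaceLie 2 w X)) (π.mkQ ψ) = _
    rw [Rat.topEquiv_symm_realPlaceLie]
    exact hLie _ _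
  simp only [hact] at key
  have key2 : π.mkQ (∑ a : Fin 2, ∑ b : Fin 2, π.lieDerivW (Rat.lieOfReal hcpt (Matrix.single a b (1 : ℝ)))
      (π.lieDerivW (Rat.lieOfReal hcpt (Matrix.single b a (1 : ℝ))) ⟨φ, hφ⟩)) =
      π.mkQ ((s₁ ^ 2 + s₂ ^ 2 - 1 / 2) • (⟨φ, hφ⟩ : π.W)) := by
    rw [map_sum, map_smul]
    simp only [map_sum]
    exact key
  rw [← sub_eq_zero, ← map_sub, Submodule.mkQ_apply, Submodule.Quotient.mk_eq_zero] at key2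
  have key3 : (((∑ a : Fin 2, ∑ b : Fin 2, π.lieDerivW (Rat.lieOfReal hcpt (Matrix.single a b (1 : ℝ)))
      (π.lieDerivW (Rat.lieOfReal hcpt (Matrix.single b a (1 : ℝ))) ⟨φ, hφ⟩)) -
        (s₁ ^ 2 + s₂ ^ 2 - 1 / 2) • (⟨φ, hφ⟩ : π.W) : π.W) : (AdelicGroupData.gl 2 ℚ).Adelic → ℂ) ∈ π.W' := key2
  have hcoe : ∀ (X Y : Matrix (Fin 2) (Fin 2) ℝ), ((π.lieDerivW (Rat.lieOfReal hcpt X) (π.lieDerivW (Rat.lieOfReal hcpt Y) ⟨φ, hφ⟩) : π.W) :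
      (AdelicGroupData.gl 2 ℚ).Adelic → ℂ) = lieDeriv Rat.iotaA (toLie X) (lieDeriv Rat.iotaA (toLie Y) φ) := fun X Y => by
    change lieDeriv (AutomorphyDatum.gl 2 ℚ hcpt).ofArch (Rat.lieOfReal hcpt X)
      (lieDeriv (AutomorphyDatum.gl 2 ℚ hcpt).ofArch (Rat.lieOfReal hcpt Y) φ) = _
    rw [Rat.lieDeriv_ofArch_lieOfReal_eq, Rat.lieDeriv_ofArch_lieOfReal_eq]
  rw [Submodule.coe_sub, Submodule.coe_smul, Submodule.coe_sum] at key3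
  simp only [Submodule.coe_sum, hcoe] at key3
  exact key3

end AutomorphicRepData

end CasimirBridge

/-! ### `Ω = C - ½ Z²` on functions -/

section OmegaIdentity

variable {G : Type*} [Group G] {ι : (RealMatrixGroup.gl ℝ (Fin 2)).carrier →* G}

/-- The matrix units in the notation of `GL2Real`: `E₁₁ = e₁₁`, …. [folklore] -/
theorem GL2Real.single_eq_e (a b : Fin 2) :
    Matrix.single a b (1 : ℝ) = (![![e₁₁, e₁₂], ![e₂₁, e₂₂]] a b) := by
  ext i j
  fin_cases a <;> fin_cases b <;> fin_cases i <;> fin_cases j <;> simp [Matrix.single, e₁₁, e₁₂, e₂₁, e₂₂]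

/-- **`Ω + ½ Z² = C` on archimedean-smooth functions**:
`(½h² + ef + fe) φ + ½ Z(Zφ) = ∑_{a,b} E_{ab}(E_{ba} φ)` (`h = E₁₁ - E₂₂`, `Z = E₁₁ + E₂₂ = 1`; bilinear
expansion of the iterated Lie derivatives). Bump 1997, §2.2 (`-4Δ = 2Ω`, the Casimir of `𝔤𝔩₂` versus
that of `𝔰𝔩₂`). [cite: Bump1997, §2.2] -/
theorem GL2Real.casimirFun_add_half_zz {φ : G → ℂ} (hφ : IsArchSmooth ι φ) :
    casimirFun ι φ + (1 / 2 : ℂ) • lieDeriv ι (toLie 1) (lieDeriv ι (toLie 1) φ) =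
      ∑ a : Fin 2, ∑ b : Fin 2, lieDeriv ι (toLie (Matrix.single a b (1 : ℝ)))
        (lieDeriv ι (toLie (Matrix.single b a (1 : ℝ))) φ) := by
  -- smoothness of the first derivatives
  have h11 := isArchSmooth_lieDeriv_toLie hφ e₁₁
  have h22 := isArchSmooth_lieDeriv_toLie hφ e₂₂
  -- `h = e₁₁ - e₂₂`, `1 = e₁₁ + e₂₂`
  have hh : toLie hMat = toLie e₁₁ - toLie e₂₂ := rfl
  have h1 : toLie (1 : Matrix (Fin 2) (Fin 2) ℝ) = toLie e₁₁ + toLie e₂₂ := by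
    rw [one_eq_e₁₁_add_e₂₂]; rfl
  -- first-order expansions
  have hd1 : lieDeriv ι (toLie hMat) φ = lieDeriv ι (toLie e₁₁) φ - lieDeriv ι (toLie e₂₂) φ := by
    rw [hh, sub_eq_add_neg, ← neg_one_smul ℝ (toLie e₂₂), hφ.lieDeriv_add_left ι, hφ.lieDeriv_smul_left ι]
    funext x; simp [sub_eq_add_neg]
  have hz1 : lieDeriv ι (toLie 1) φ = lieDeriv ι (toLie e₁₁) φ + lieDeriv ι (toLie e₂₂) φ := by
    rw [h1, hφ.lieDeriv_add_left ι]
  have hsub : IsArchSmooth ι (lieDeriv ι (toLie e₁₁) φ - lieDeriv ι (toLie e₂₂) φ) := by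
    have h := h11.add ι (h22.smul ι (-1)); simpa [sub_eq_add_neg] using h
  have hadd : IsArchSmooth ι (lieDeriv ι (toLie e₁₁) φ + lieDeriv ι (toLie e₂₂) φ) := h11.add ι h22
  -- second-order expansions
  have hd2 : lieDeriv ι (toLie hMat) (lieDeriv ι (toLie hMat) φ) =
      lieDeriv ι (toLie e₁₁) (lieDeriv ι (toLie e₁₁) φ) - lieDeriv ι (toLie e₁₁) (lieDeriv ι (toLie e₂₂) φ) -
        (lieDeriv ι (toLie e₂₂) (lieDeriv ι (toLie e₁₁) φ) - lieDeriv ι (toLie e₂₂) (lieDeriv ι (toLie e₂₂) φ)) := by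
    rw [hd1, hh, sub_eq_add_neg (toLie e₁₁), ← neg_one_smul ℝ (toLie e₂₂), hsub.lieDeriv_add_left ι,
      hsub.lieDeriv_smul_left ι, lieDeriv_sub_of_isArchSmooth _ h11 h22, lieDeriv_sub_of_isArchSmooth _ h11 h22]
    funext x
    simp only [Pi.add_apply, Pi.sub_apply, Pi.smul_apply, Complex.real_smul]
    push_cast
    ring
  have hz2 : lieDeriv ι (toLie 1) (lieDeriv ι (toLie 1) φ) =
      lieDeriv ι (toLie e₁₁) (lieDeriv ι (toLie e₁₁) φ) + lieDeriv ι (toLie e₁₁) (lieDeriv ι (toLie e₂₂) φ) +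
        (lieDeriv ι (toLie e₂₂) (lieDeriv ι (toLie e₁₁) φ) + lieDeriv ι (toLie e₂₂) (lieDeriv ι (toLie e₂₂) φ)) := by
    rw [hz1, h1, hadd.lieDeriv_add_left ι, IsArchSmooth.lieDeriv_add ι _ h11 h22, IsArchSmooth.lieDeriv_add ι _ h11 h22]
  unfold casimirFun
  rw [hd2, hz2]
  simp only [Fin.sum_univ_two, GL2Real.single_eq_e]
  funext x
  simp only [Pi.add_apply, Pi.sub_apply, Pi.smul_apply, smul_eq_mul, Matrix.cons_val_zero, Matrix.cons_val_one]
  ring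

end OmegaIdentity

/-! ### Assembly: a weight-one vector killed by `X` in an automorphic representation of weight one -/

section WeightOne

variable {hcpt : isCompact_glFiniteIntegralLevel 2 ℚ}

/-- `(-1 : GL₂(ℝ)) ⊗ 1 = -1`. [folklore] -/
theorem Rat.realToMixedGL_neg_one : Rat.realToMixedGL 2 (-1) = -1 :=
  generalLinearGroup_map_neg_one _

/-- **`ι_𝔸(k_π) = -1_∞`**: right translation by `ι_𝔸(k_π)` is right translation by the archimedean
`-1` of the datum. [folklore] -/
theorem Rat.iotaA_rotK_pi :
    Rat.iotaA (rotK Real.pi) = (AutomorphyDatum.gl 2 ℚ hcpt).ofArch ⟨-1, trivial⟩ := by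
  change (show (AdelicGroupData.gl 2 ℚ).Adelic from Rat.ofRealGL 2 ((rotK Real.pi : (RealMatrixGroup.gl ℝ (Fin 2)).carrier) : GL (Fin 2) ℝ)) = _
  rw [coe_rotK_pi, Rat.ofRealGL_eq_ofInfinite, Rat.realToMixedGL_neg_one]
  rfl

namespace AutomorphicRepData

variable (π : AutomorphicRepData (AutomorphyDatum.gl 2 ℚ hcpt))

/-- Elements of `W` are automorphic forms (for `GL_n` the span of the automorphic forms is the set
of automorphic forms). [cite: BorelJacquetCorvallis1979, 4.6] -/
theorem isAutomorphicForm_of_mem_W {φ : (AdelicGroupData.gl 2 ℚ).Adelic → ℂ} (hφ : φ ∈ π.W) :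
    IsAutomorphicForm (AutomorphyDatum.gl 2 ℚ hcpt) φ :=
  isAutomorphicForm_of_mem_automorphicForms_gl (π.stable.le_automorphicForms hφ)

/-- The rotation translates `r(ι_𝔸 k_θ) φ` of `φ ∈ W` lie in `W` (`K_∞`-stability). [cite: BorelJacquetCorvallis1979, 4.6] -/
theorem archTranslate_iotaA_rotK_mem {φ : (AdelicGroupData.gl 2 ℚ).Adelic → ℂ} (hφ : φ ∈ π.W) (θ : ℝ) :
    archTranslate Rat.iotaA (rotK θ) φ ∈ π.W := by
  rw [Rat.archTranslate_iotaA_eq_rightTranslation_ofK (hcpt := hcpt) _ (transpose_rotK_mul θ)]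
  exact π.stable.k_stable _ hφ

/-- The reflected function `r(ι_𝔸 ε) φ` of `φ ∈ W` lies in `W`. [cite: BorelJacquetCorvallis1979, 4.6] -/
theorem archTranslate_iotaA_epsK_mem {φ : (AdelicGroupData.gl 2 ℚ).Adelic → ℂ} (hφ : φ ∈ π.W) :
    archTranslate Rat.iotaA epsK φ ∈ π.W := by
  rw [Rat.archTranslate_iotaA_eq_rightTranslation_ofK (hcpt := hcpt) _ transpose_epsK_mul]
  exact π.stable.k_stable _ hφ

/-- **`K_∞`-finiteness gives `SO(2)`-finiteness along `ι_𝔸`**: the rotation translates of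
`φ ∈ W` span a finite-dimensional rotation-stable subspace of any rotation-stable `W₁ ∋ φ`.
[cite: BorelJacquetCorvallis1979, 4.2 (b)] -/
theorem exists_finiteDimensional_rotation_span {W₁ : Submodule ℂ ((AdelicGroupData.gl 2 ℚ).Adelic → ℂ)}
    (hW₁ : W₁ ≤ π.W) (hrot : ∀ θ : ℝ, ∀ ψ ∈ W₁, archTranslate Rat.iotaA (rotK θ) ψ ∈ W₁)
    {φ : (AdelicGroupData.gl 2 ℚ).Adelic → ℂ} (hφ : φ ∈ W₁) :
    ∃ V : Submodule ℂ ((AdelicGroupData.gl 2 ℚ).Adelic → ℂ), FiniteDimensional ℂ V ∧ φ ∈ V ∧ V ≤ W₁ ∧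
      ∀ θ : ℝ, ∀ ψ ∈ V, archTranslate Rat.iotaA (rotK θ) ψ ∈ V := by
  set V : Submodule ℂ ((AdelicGroupData.gl 2 ℚ).Adelic → ℂ) :=
    Submodule.span ℂ (Set.range fun θ : ℝ => archTranslate Rat.iotaA (rotK θ) φ) with hV
  have hkf : FiniteDimensional ℂ (kTranslateSpan (AutomorphyDatum.gl 2 ℚ hcpt).ofArch φ) :=
    (π.isAutomorphicForm_of_mem_W (hW₁ hφ)).kFinite
  have hle : V ≤ kTranslateSpan (AutomorphyDatum.gl 2 ℚ hcpt).ofArch φ := by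
    refine Submodule.span_le.2 ?_
    rintro _ ⟨θ, rfl⟩
    have h := archTranslate_mem_kTranslateSpan (AutomorphyDatum.gl 2 ℚ hcpt).ofArch
      ⟨Rat.realToMixedGL 2 ((rotK θ : (RealMatrixGroup.gl ℝ (Fin 2)).carrier) : GL (Fin 2) ℝ),
        Rat.realToMixedGL_mem_maximalCompact (transpose_rotK_mul θ)⟩ φ
    change archTranslate Rat.iotaA (rotK θ) φ ∈ kTranslateSpan (AutomorphyDatum.gl 2 ℚ hcpt).ofArch φ
    rw [Rat.archTranslate_iotaA_eq_rightTranslation_ofK (hcpt := hcpt) _ (transpose_rotK_mul θ)]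
    exact h
  refine ⟨V, Submodule.finiteDimensional_of_le hle, ?_, ?_, ?_⟩
  · have h : archTranslate Rat.iotaA (rotK 0) φ = φ := by rw [rotK_zero, map_one, Module.End.one_apply]
    rw [← h]
    exact Submodule.subset_span ⟨0, rfl⟩
  · exact Submodule.span_le.2 (by rintro _ ⟨θ, rfl⟩; exact hrot θ φ hφ)
  · intro θ ψ hψ
    have hmap : V.map (archTranslate Rat.iotaA (rotK θ)) ≤ V := by
      rw [hV, Submodule.map_span, Submodule.span_le]
      rintro _ ⟨_, ⟨θ', rfl⟩, rfl⟩
      refine Submodule.subset_span ⟨θ + θ', ?_⟩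
      change archTranslate Rat.iotaA (rotK (θ + θ')) φ = archTranslate Rat.iotaA (rotK θ) (archTranslate Rat.iotaA (rotK θ') φ)
      rw [rotK_add, map_mul, Module.End.mul_apply]
    exact hmap ⟨ψ, hψ, rfl⟩

/-- **A weight-one automorphic representation of `GL₂(𝔸_ℚ)` realised as a subrepresentation
(`W' = ⊥`) contains, in every `(𝔤𝔩₂(ℝ), ⟨k_θ, ε⟩)`-stable subspace `W₁ ≤ W` containing a non-zero
vector, a non-zero vector of `SO(2)`-weight one killed by the lowering operator `X` and by `Z`.**
Inputs: `IsOfWeightOne` (Harish-Chandra parameter `{0, 0}` — so `C = -1/2`, `Z = 0` on `W`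
(`sum_lieDeriv_single_sub_smul_mem`, `lieDeriv_one_sub_smul_mem`, exact as `W' = ⊥`), hence
`Ω = C - ½Z² = -1/2` (`GL2Real.casimirFun_add_half_zz`) — and the sign `k_π = -1_∞` acts by `-1`),
`K_∞`-finiteness (`exists_finiteDimensional_rotation_span`) and the extraction
`GL2Real.exists_isWeightVec_one_lowerFun_eq_zero_of_finite`. This is Gelbart 1997, Remark 2.5.2 /
2.5.5 (`π_∞ = π(1, sgn)` has a weight-one vector with `X · φ = 0`) for the datum `π`.
[cite: Gelbart1997, Remark 2.5.5] [cite: Bump1997, Exercise 2.1.7] -/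
theorem exists_isWeightVec_one_of_isOfWeightOne (hbot : π.W' = ⊥) (h1 : π.IsOfWeightOne)
    {W₁ : Submodule ℂ ((AdelicGroupData.gl 2 ℚ).Adelic → ℂ)} (hW₁ : W₁ ≤ π.W)
    (heps : ∀ φ ∈ W₁, archTranslate Rat.iotaA epsK φ ∈ W₁)
    (hrot : ∀ θ : ℝ, ∀ φ ∈ W₁, archTranslate Rat.iotaA (rotK θ) φ ∈ W₁)
    (hlie : ∀ (X : Matrix (Fin 2) (Fin 2) ℝ), ∀ φ ∈ W₁, lieDeriv Rat.iotaA (toLie X) φ ∈ W₁)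
    {φ : (AdelicGroupData.gl 2 ℚ).Adelic → ℂ} (hφ : φ ∈ W₁) (hφ0 : φ ≠ 0) :
    ∃ ψ ∈ W₁, ψ ≠ 0 ∧ IsWeightVec Rat.iotaA 1 ψ ∧ lowerFun Rat.iotaA ψ = 0 ∧
      lieDeriv Rat.iotaA (toLie 1) ψ = 0 := by
  have hsmooth : ∀ ψ ∈ W₁, IsArchSmooth Rat.iotaA ψ := fun ψ hψ =>
    (π.isArchSmooth_of_mem_W (hW₁ hψ)).iotaA
  -- `Z ψ = 0` and `C ψ = -½ ψ` exactly on `W`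
  have hZ : ∀ ψ ∈ π.W, lieDeriv Rat.iotaA (toLie 1) ψ = 0 := fun ψ hψ => by
    have h := π.lieDeriv_one_sub_smul_mem h1.1 hψ
    rw [hbot, Submodule.mem_bot, add_zero, zero_smul, sub_zero] at h
    exact h
  have hcas : ∀ ψ ∈ W₁, casimirFun Rat.iotaA ψ = (-(1 / 2 : ℂ)) • ψ := fun ψ hψ => by
    have h := π.sum_lieDeriv_single_sub_smul_mem h1.1 (hW₁ hψ)
    rw [hbot, Submodule.mem_bot, sub_eq_zero] at h
    have hid := GL2Real.casimirFun_add_half_zz (hsmooth ψ hψ)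
    rw [hZ ψ (hW₁ hψ), lieDeriv_zero_right, smul_zero, add_zero] at hid
    rw [hid, h]
    norm_num
  have hneg : ∀ ψ ∈ W₁, ∀ g, ψ (g * Rat.iotaA (rotK Real.pi)) = -ψ g := fun ψ hψ g => by
    have h := h1.2 ψ (hW₁ hψ)
    rw [hbot, Submodule.mem_bot] at h
    have hg := congrFun h g
    rw [Pi.add_apply, Pi.zero_apply, rightTranslation_apply, ← Rat.iotaA_rotK_pi (hcpt := hcpt)] at hg
    linear_combination hg
  obtain ⟨ψ, hψW, hψ0, hw, hL⟩ := exists_isWeightVec_one_lowerFun_eq_zero_of_finite hsmooth heps hlie hcas hneg hφ0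
    (π.exists_finiteDimensional_rotation_span hW₁ hrot hφ)
  exact ⟨ψ, hψW, hψ0, hw, hL, hZ ψ (hW₁ hψW)⟩

/-- The same for `W₁ = W`. [cite: Gelbart1997, Remark 2.5.5] -/
theorem exists_isWeightVec_one_of_isOfWeightOne' (hbot : π.W' = ⊥) (h1 : π.IsOfWeightOne)
    {φ : (AdelicGroupData.gl 2 ℚ).Adelic → ℂ} (hφ : φ ∈ π.W) (hφ0 : φ ≠ 0) :
    ∃ ψ ∈ π.W, ψ ≠ 0 ∧ IsWeightVec Rat.iotaA 1 ψ ∧ lowerFun Rat.iotaA ψ = 0 ∧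
      lieDeriv Rat.iotaA (toLie 1) ψ = 0 :=
  π.exists_isWeightVec_one_of_isOfWeightOne hbot h1 le_rfl (fun _ h => π.archTranslate_iotaA_epsK_mem h)
    (fun θ _ h => π.archTranslate_iotaA_rotK_mem h θ) (fun X _ h => π.lieDeriv_iotaA_mem h X) hφ hφ0

end AutomorphicRepData

end WeightOne

end Literature.NumberTheory.Automorphic

end
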